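import Mathlib
import Literature.Analysis.FluidPDE.TypeIICoreWitness
import Literature.Analysis.FluidPDE.VectorCalculus
import Summits.NavierStokesRegularity.NavierStokesRegularity.Theorems.TypeIIInviscidRelaxationColumnarCoreExclusionDivCorrector
import Summits.NavierStokesRegularity.NavierStokesRegularity.Theorems.TypeIIInviscidRelaxationColumnarCoreExclusionStreamFunction
import HarnessLib

/-!
# Crux `ColumnarCoreExclusion` (stmt-NavierStokesRegularity-1966), line `columnar_comparison_flow`:
# divergence-free columnar cut-off through the stream function (second half of step R3c of the datum of
# `stub_columnarComparisonFlow`)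

`--supports stmt-NavierStokesRegularity-1966` (helper file; theorems only, no definitions, no `sorry`).

Given a smooth, divergence-free, columnar field `w` on `ℝ³` with stream function `ψ`
(`…ColumnarCoreExclusionStreamFunction`: `∂₁ψ = w₀`, `∂₀ψ = −w₁`, `ψ` smooth and columnar) and radii
`0 < R < R'`, the field

  `v = χ w + ψ z`,  `χ(Y) = φ(Y₀² + Y₁²)`,  `z(Y) = 2φ'(Y₀² + Y₁²) (Y₁ e₀ − Y₀ e₁) = (∂₁χ, −∂₀χ, 0)`,

with `φ(ρ) = smoothTransition((R'² − ρ)/(R'² − R²))`, is smooth, EXACTLY columnar, EXACTLY divergence free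
(`div v = ∇χ·w + χ div w + ∇ψ·z + ψ div z`, and `∇ψ·z = −∇χ·w`, `div z = 0`, `div w = 0`), equals `w` on the
open cylinder `Y₀² + Y₁² < R²`, vanishes outside the cylinder of radius `R'`, and is bounded
(`exists_divFree_columnar_cutoff`).  This is the horizontally compactly supported form of the comparison
datum needed to launch a 2½-dimensional flow.

WHAT THIS IS NOT: the 2½-dimensional launch (2D Navier–Stokes on `𝕋²` is in the tree; the passive-scalar
vertical component and the columnar lift are not), the shadowing stub.  Nothing here closes a stub, the
crux, or says anything about Navier–Stokes regularity.
-/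

noncomputable section

open Literature.Analysis.FluidPDE Literature.Analysis.Calculus Set Metric MeasureTheory Real Function Filter
open scoped RealInnerProductSpace ContDiff Topology

namespace Summit.NavierStokesRegularity.NavierStokesRegularity.Theorems

-- the problem directory repeats the summit name (`NavierStokesRegularity/NavierStokesRegularity`)
set_option linter.dupNamespace false

namespace ColumnarComparisonDatum

section Cutoff

variable {w : EuclideanSpace ℝ (Fin 3) → EuclideanSpace ℝ (Fin 3)} {ψ χ : EuclideanSpace ℝ (Fin 3) → ℝ}
  {z : EuclideanSpace ℝ (Fin 3) → EuclideanSpace ℝ (Fin 3)} {φ : ℝ → ℝ} {R R' : ℝ}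

/-- The radial profile `φ(ρ) = smoothTransition((R'² − ρ)/(R'² − R²))` is smooth. [folklore] -/
theorem contDiff_profile (hφ : φ = fun ρ => Real.smoothTransition ((R' ^ 2 - ρ) / (R' ^ 2 - R ^ 2))) :
    ContDiff ℝ ∞ φ := by
  rw [hφ]
  exact Real.smoothTransition.contDiff.comp ((contDiff_const.sub contDiff_id).div_const _)

/-- The profile is `1` on `ρ ≤ R²` (`R < R'`). [folklore] -/
theorem profile_eq_one (hφ : φ = fun ρ => Real.smoothTransition ((R' ^ 2 - ρ) / (R' ^ 2 - R ^ 2)))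
    (hR : 0 ≤ R) (hRR' : R < R') {ρ : ℝ} (hρ : ρ ≤ R ^ 2) : φ ρ = 1 := by
  rw [hφ]
  have hden : 0 < R' ^ 2 - R ^ 2 := by nlinarith
  exact Real.smoothTransition.one_of_one_le ((one_le_div hden).2 (by linarith))

/-- The profile is `0` on `R'² ≤ ρ` (`R < R'`). [folklore] -/
theorem profile_eq_zero (hφ : φ = fun ρ => Real.smoothTransition ((R' ^ 2 - ρ) / (R' ^ 2 - R ^ 2)))
    (hR : 0 ≤ R) (hRR' : R < R') {ρ : ℝ} (hρ : R' ^ 2 ≤ ρ) : φ ρ = 0 := by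
  rw [hφ]
  have hden : 0 < R' ^ 2 - R ^ 2 := by nlinarith
  exact Real.smoothTransition.zero_of_nonpos (div_nonpos_of_nonpos_of_nonneg (by linarith) hden.le)

/-- The derivative of the profile vanishes on the open plateau `ρ < R²`. [folklore] -/
theorem deriv_profile_eq_zero_of_lt
    (hφ : φ = fun ρ => Real.smoothTransition ((R' ^ 2 - ρ) / (R' ^ 2 - R ^ 2)))
    (hR : 0 ≤ R) (hRR' : R < R') {ρ : ℝ} (hρ : ρ < R ^ 2) : deriv φ ρ = 0 := by
  have h : φ =ᶠ[𝓝 ρ] fun _ => (1 : ℝ) :=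
    (eventually_lt_nhds hρ).mono fun ρ' hρ' => profile_eq_one hφ hR hRR' hρ'.le
  rw [h.deriv_eq, deriv_const]

/-- The derivative of the profile vanishes outside, `R'² < ρ`. [folklore] -/
theorem deriv_profile_eq_zero_of_gt
    (hφ : φ = fun ρ => Real.smoothTransition ((R' ^ 2 - ρ) / (R' ^ 2 - R ^ 2)))
    (hR : 0 ≤ R) (hRR' : R < R') {ρ : ℝ} (hρ : R' ^ 2 < ρ) : deriv φ ρ = 0 := by
  have h : φ =ᶠ[𝓝 ρ] fun _ => (0 : ℝ) :=
    (eventually_gt_nhds hρ).mono fun ρ' hρ' => profile_eq_zero hφ hR hRR' hρ'.le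
  rw [h.deriv_eq, deriv_const]

/-- Derivative of `ε ↦ Φ((Y + εe₀)₀² + (Y + εe₀)₁²)` at `0` for a differentiable `Φ`: `Φ'(ρ) · 2Y₀`.
[folklore] -/
theorem hasDerivAt_radial_e0 {Φ : ℝ → ℝ} (hΦ : Differentiable ℝ Φ) (Y : EuclideanSpace ℝ (Fin 3)) :
    HasDerivAt (fun ε : ℝ => Φ ((Y + ε • EuclideanSpace.single (0 : Fin 3) (1 : ℝ)) 0 ^ 2 +
      (Y + ε • EuclideanSpace.single (0 : Fin 3) (1 : ℝ)) 1 ^ 2)) (deriv Φ (Y 0 ^ 2 + Y 1 ^ 2) * (2 * Y 0)) 0 := by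
  have e : (fun ε : ℝ => Φ ((Y + ε • EuclideanSpace.single (0 : Fin 3) (1 : ℝ)) 0 ^ 2 +
      (Y + ε • EuclideanSpace.single (0 : Fin 3) (1 : ℝ)) 1 ^ 2)) = fun ε => Φ ((Y 0 + ε) ^ 2 + Y 1 ^ 2) := by
    funext ε; simp
  rw [e]
  have hin : HasDerivAt (fun ε : ℝ => (Y 0 + ε) ^ 2 + Y 1 ^ 2) (2 * Y 0) 0 := by
    have := (((hasDerivAt_id (0 : ℝ)).const_add (Y 0)).pow 2).add_const (Y 1 ^ 2)
    simpa using this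
  have := (hΦ ((Y 0 + 0) ^ 2 + Y 1 ^ 2)).hasDerivAt.comp (0 : ℝ) hin
  simpa [Function.comp_def] using this

/-- Derivative of `ε ↦ Φ((Y + εe₁)₀² + (Y + εe₁)₁²)` at `0`: `Φ'(ρ) · 2Y₁`. [folklore] -/
theorem hasDerivAt_radial_e1 {Φ : ℝ → ℝ} (hΦ : Differentiable ℝ Φ) (Y : EuclideanSpace ℝ (Fin 3)) :
    HasDerivAt (fun ε : ℝ => Φ ((Y + ε • EuclideanSpace.single (1 : Fin 3) (1 : ℝ)) 0 ^ 2 +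
      (Y + ε • EuclideanSpace.single (1 : Fin 3) (1 : ℝ)) 1 ^ 2)) (deriv Φ (Y 0 ^ 2 + Y 1 ^ 2) * (2 * Y 1)) 0 := by
  have e : (fun ε : ℝ => Φ ((Y + ε • EuclideanSpace.single (1 : Fin 3) (1 : ℝ)) 0 ^ 2 +
      (Y + ε • EuclideanSpace.single (1 : Fin 3) (1 : ℝ)) 1 ^ 2)) = fun ε => Φ (Y 0 ^ 2 + (Y 1 + ε) ^ 2) := by
    funext ε; simp
  rw [e]
  have hin : HasDerivAt (fun ε : ℝ => Y 0 ^ 2 + (Y 1 + ε) ^ 2) (2 * Y 1) 0 := by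
    have := (((hasDerivAt_id (0 : ℝ)).const_add (Y 1)).pow 2).const_add (Y 0 ^ 2)
    simpa using this
  have := (hΦ (Y 0 ^ 2 + (Y 1 + 0) ^ 2)).hasDerivAt.comp (0 : ℝ) hin
  simpa [Function.comp_def] using this

/-- **The divergence-free columnar cut-off.**  `w` smooth, divergence free, columnar with stream function
`ψ`; `0 < R < R'`.  Then there is a smooth, EXACTLY divergence-free, EXACTLY columnar `v` with `v = w` on
`Y₀² + Y₁² < R²`, `v = 0` on `R'² < Y₀² + Y₁²`, and `v` bounded. [folklore] -/
theorem exists_divFree_columnar_cutoff (hw : ContDiff ℝ ∞ w) (hdiv : VectorCalculus.IsDivFree w)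
    (hcol : IsColumnar w)
    (hψ : ψ = fun Y => (∫ s in (0 : ℝ)..(Y 1), w (Y + (s - Y 1) • EuclideanSpace.single 1 1) 0) -
      ∫ s in (0 : ℝ)..(Y 0), w (s • EuclideanSpace.single 0 1) 1)
    (hR : 0 < R) (hRR' : R < R') :
    ∃ v : EuclideanSpace ℝ (Fin 3) → EuclideanSpace ℝ (Fin 3),
      ContDiff ℝ ∞ v ∧ VectorCalculus.IsDivFree v ∧ IsColumnar v ∧
      (∀ Y, Y 0 ^ 2 + Y 1 ^ 2 < R ^ 2 → v Y = w Y) ∧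
      (∀ Y, R' ^ 2 < Y 0 ^ 2 + Y 1 ^ 2 → v Y = 0) ∧
      (∃ M, ∀ Y, ‖v Y‖ ≤ M) := by
  obtain ⟨φ, hφ⟩ : ∃ φ : ℝ → ℝ,
      φ = fun ρ => Real.smoothTransition ((R' ^ 2 - ρ) / (R' ^ 2 - R ^ 2)) := ⟨_, rfl⟩
  have hφs : ContDiff ℝ ∞ φ := contDiff_profile hφ
  have hφd : Differentiable ℝ φ := hφs.differentiable (by simp)
  have hφ's : ContDiff ℝ ∞ (deriv φ) := (contDiff_infty_iff_deriv.1 hφs).2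
  have hφ'd : Differentiable ℝ (deriv φ) := hφ's.differentiable (by simp)
  have hψs : ContDiff ℝ ∞ ψ := contDiff_stream hw hψ
  have hwd : Differentiable ℝ w := hw.differentiable (by simp)
  -- the pieces
  have hρs : ContDiff ℝ ∞ fun Y : EuclideanSpace ℝ (Fin 3) => Y 0 ^ 2 + Y 1 ^ 2 :=
    ((contDiff_euclidean.1 contDiff_id (0 : Fin 3)).pow 2).add ((contDiff_euclidean.1 contDiff_id (1 : Fin 3)).pow 2)
  set χ : EuclideanSpace ℝ (Fin 3) → ℝ := fun Y => φ (Y 0 ^ 2 + Y 1 ^ 2) with hχ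
  set z : EuclideanSpace ℝ (Fin 3) → EuclideanSpace ℝ (Fin 3) := fun Y =>
    (2 * deriv φ (Y 0 ^ 2 + Y 1 ^ 2)) • ((Y 1) • EuclideanSpace.single 0 1 - (Y 0) • EuclideanSpace.single 1 1)
    with hz
  have hχs : ContDiff ℝ ∞ χ := hφs.comp hρs
  have hzs : ContDiff ℝ ∞ z := by
    have h1 : ContDiff ℝ ∞ fun Y : EuclideanSpace ℝ (Fin 3) => 2 * deriv φ (Y 0 ^ 2 + Y 1 ^ 2) :=
      contDiff_const.mul (hφ's.comp hρs)
    have hY1 : ContDiff ℝ ∞ fun Y : EuclideanSpace ℝ (Fin 3) => Y 1 := contDiff_euclidean.1 contDiff_id (1 : Fin 3)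
    have hY0 : ContDiff ℝ ∞ fun Y : EuclideanSpace ℝ (Fin 3) => Y 0 := contDiff_euclidean.1 contDiff_id (0 : Fin 3)
    have ha : ContDiff ℝ ∞ fun Y : EuclideanSpace ℝ (Fin 3) => (Y 1) • EuclideanSpace.single (0 : Fin 3) (1 : ℝ) := hY1.smul contDiff_const
    have hb : ContDiff ℝ ∞ fun Y : EuclideanSpace ℝ (Fin 3) => (Y 0) • EuclideanSpace.single (1 : Fin 3) (1 : ℝ) := hY0.smul contDiff_const
    have h2 : ContDiff ℝ ∞ fun Y : EuclideanSpace ℝ (Fin 3) =>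
        (Y 1) • EuclideanSpace.single (0 : Fin 3) (1 : ℝ) - (Y 0) • EuclideanSpace.single 1 1 := ha.sub hb
    exact h1.smul h2
  set v : EuclideanSpace ℝ (Fin 3) → EuclideanSpace ℝ (Fin 3) := fun Y => χ Y • w Y + ψ Y • z Y with hv
  have hvs : ContDiff ℝ ∞ v := (hχs.smul hw).add (hψs.smul hzs)
  -- columnarity
  have hχcol : ∀ (Y : EuclideanSpace ℝ (Fin 3)) (σ : ℝ), χ (Y + σ • eZ) = χ Y := fun Y σ => by
    simp only [hχ, add_smul_eZ_apply_zero, add_smul_eZ_apply_one]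
  have hzcol : ∀ (Y : EuclideanSpace ℝ (Fin 3)) (σ : ℝ), z (Y + σ • eZ) = z Y := fun Y σ => by
    simp only [hz, add_smul_eZ_apply_zero, add_smul_eZ_apply_one]
  have hψcol : ∀ (Y : EuclideanSpace ℝ (Fin 3)) (σ : ℝ), ψ (Y + σ • eZ) = ψ Y := columnar_stream hcol hψ
  have hvcol : IsColumnar v := fun Y σ => by
    simp only [hv, hχcol, hzcol, hψcol, hcol Y σ]
  refine ⟨v, hvs, ?_, hvcol, ?_, ?_, ?_⟩
  · -- divergence free
    intro Y
    have hvd : DifferentiableAt ℝ v Y := (hvs.differentiable (by simp)) Y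
    have d0 := hasDerivAt_apply_line hvd (EuclideanSpace.single 0 1) 0
    have d1 := hasDerivAt_apply_line hvd (EuclideanSpace.single 1 1) 1
    have d2 := hasDerivAt_apply_line hvd eZ 2
    -- `e_z`
    have d2' : HasDerivAt (fun ε : ℝ => v (Y + ε • eZ) 2) 0 0 := by
      have e : (fun ε : ℝ => v (Y + ε • eZ) 2) = fun _ => v Y 2 := funext fun ε => by rw [hvcol Y ε]
      rw [e]; exact hasDerivAt_const _ _
    -- the scalar pieces along `e₀` and `e₁`
    set ρ : ℝ := Y 0 ^ 2 + Y 1 ^ 2 with hρ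
    have hχ0 : HasDerivAt (fun ε : ℝ => χ (Y + ε • EuclideanSpace.single 0 1)) (deriv φ ρ * (2 * Y 0)) 0 :=
      hasDerivAt_radial_e0 hφd Y
    have hχ1 : HasDerivAt (fun ε : ℝ => χ (Y + ε • EuclideanSpace.single 1 1)) (deriv φ ρ * (2 * Y 1)) 0 :=
      hasDerivAt_radial_e1 hφd Y
    have hψ0 := hasDerivAt_stream_e0 hw hdiv hcol hψ Y
    have hψ1 := hasDerivAt_stream_e1 hw hψ Y
    have hw00 := hasDerivAt_apply_line (hwd Y) (EuclideanSpace.single 0 1) 0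
    have hw11 := hasDerivAt_apply_line (hwd Y) (EuclideanSpace.single 1 1) 1
    -- components of `z` along the lines
    have hz0 : HasDerivAt (fun ε : ℝ => z (Y + ε • EuclideanSpace.single 0 1) 0)
        (deriv (deriv φ) ρ * (2 * Y 0) * (2 * Y 1)) 0 := by
      have e : (fun ε : ℝ => z (Y + ε • EuclideanSpace.single 0 1) 0) = fun ε =>
          deriv φ ((Y + ε • EuclideanSpace.single (0 : Fin 3) (1 : ℝ)) 0 ^ 2 + (Y + ε • EuclideanSpace.single (0 : Fin 3) (1 : ℝ)) 1 ^ 2) *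
            (2 * Y 1) := by
        funext ε; simp [hz]; ring
      rw [e]
      exact (hasDerivAt_radial_e0 hφ'd Y).mul_const _
    have hz1 : HasDerivAt (fun ε : ℝ => z (Y + ε • EuclideanSpace.single 1 1) 1)
        (-(deriv (deriv φ) ρ * (2 * Y 1) * (2 * Y 0))) 0 := by
      have e : (fun ε : ℝ => z (Y + ε • EuclideanSpace.single 1 1) 1) = fun ε =>
          -(deriv φ ((Y + ε • EuclideanSpace.single (1 : Fin 3) (1 : ℝ)) 0 ^ 2 + (Y + ε • EuclideanSpace.single (1 : Fin 3) (1 : ℝ)) 1 ^ 2) *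
            (2 * Y 0)) := by
        funext ε; simp [hz]; ring
      rw [e]
      exact ((hasDerivAt_radial_e1 hφ'd Y).mul_const _).neg
    have hzY0 : z Y 0 = 2 * deriv φ ρ * Y 1 := by simp [hz, hρ]
    have hzY1 : z Y 1 = -(2 * deriv φ ρ * Y 0) := by simp [hz, hρ]
    -- the components of `v` along the lines
    have d0' : HasDerivAt (fun ε : ℝ => v (Y + ε • EuclideanSpace.single 0 1) 0)
        (deriv φ ρ * (2 * Y 0) * w Y 0 + χ Y * fderiv ℝ w Y (EuclideanSpace.single 0 1) 0 +
          (-(w Y 1) * z Y 0 + ψ Y * (deriv (deriv φ) ρ * (2 * Y 0) * (2 * Y 1)))) 0 := by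
      have e : (fun ε : ℝ => v (Y + ε • EuclideanSpace.single 0 1) 0) =
          ((fun ε : ℝ => χ (Y + ε • EuclideanSpace.single (0 : Fin 3) (1 : ℝ))) * fun ε : ℝ => w (Y + ε • EuclideanSpace.single (0 : Fin 3) (1 : ℝ)) 0) +
            ((fun ε : ℝ => ψ (Y + ε • EuclideanSpace.single (0 : Fin 3) (1 : ℝ))) * fun ε : ℝ => z (Y + ε • EuclideanSpace.single (0 : Fin 3) (1 : ℝ)) 0) := by
        funext ε; simp [hv]
      rw [e]
      refine ((hχ0.mul hw00).add (hψ0.mul hz0)).congr_deriv ?_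
      simp
    have d1' : HasDerivAt (fun ε : ℝ => v (Y + ε • EuclideanSpace.single 1 1) 1)
        (deriv φ ρ * (2 * Y 1) * w Y 1 + χ Y * fderiv ℝ w Y (EuclideanSpace.single 1 1) 1 +
          (w Y 0 * z Y 1 + ψ Y * (-(deriv (deriv φ) ρ * (2 * Y 1) * (2 * Y 0))))) 0 := by
      have e : (fun ε : ℝ => v (Y + ε • EuclideanSpace.single 1 1) 1) =
          ((fun ε : ℝ => χ (Y + ε • EuclideanSpace.single (1 : Fin 3) (1 : ℝ))) * fun ε : ℝ => w (Y + ε • EuclideanSpace.single (1 : Fin 3) (1 : ℝ)) 1) +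
            ((fun ε : ℝ => ψ (Y + ε • EuclideanSpace.single (1 : Fin 3) (1 : ℝ))) * fun ε : ℝ => z (Y + ε • EuclideanSpace.single (1 : Fin 3) (1 : ℝ)) 1) := by
        funext ε; simp [hv]
      rw [e]
      refine ((hχ1.mul hw11).add (hψ1.mul hz1)).congr_deriv ?_
      simp
    have hdw : fderiv ℝ w Y (EuclideanSpace.single 0 1) 0 + fderiv ℝ w Y (EuclideanSpace.single 1 1) 1 = 0 := by
      have h := hdiv Y
      rw [divergence_eq_sum_three, fderiv_eZ_eq_zero_of_columnar hwd hcol] at h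
      simpa using h
    rw [divergence_eq_sum_three, d0.unique d0', d1.unique d1', d2.unique d2', hzY0, hzY1]
    have : χ Y * fderiv ℝ w Y (EuclideanSpace.single 0 1) 0 + χ Y * fderiv ℝ w Y (EuclideanSpace.single 1 1) 1 = 0 := by
      rw [← mul_add, hdw, mul_zero]
    linear_combination this
  · -- `v = w` on the inner open cylinder
    intro Y hY
    have h1 : χ Y = 1 := profile_eq_one hφ hR.le hRR' hY.le
    have h2 : z Y = 0 := by
      simp only [hz, deriv_profile_eq_zero_of_lt hφ hR.le hRR' hY, mul_zero, zero_smul]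
    simp only [hv, h1, h2, one_smul, smul_zero, add_zero]
  · -- `v = 0` outside
    intro Y hY
    have h1 : χ Y = 0 := profile_eq_zero hφ hR.le hRR' hY.le
    have h2 : z Y = 0 := by
      simp only [hz, deriv_profile_eq_zero_of_gt hφ hR.le hRR' hY, mul_zero, zero_smul]
    simp only [hv, h1, h2, zero_smul, smul_zero, add_zero]
  · -- bounded: columnar and vanishing outside the cylinder of radius `R'`
    obtain ⟨M, hM⟩ := (isCompact_closedBall (0 : EuclideanSpace ℝ (Fin 3)) R').exists_bound_of_continuousOn
      hvs.continuous.continuousOn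
    refine ⟨max M 0, fun Y => ?_⟩
    by_cases hY : R' ^ 2 < Y 0 ^ 2 + Y 1 ^ 2
    · have h1 : χ Y = 0 := profile_eq_zero hφ hR.le hRR' hY.le
      have h2 : z Y = 0 := by
        simp only [hz, deriv_profile_eq_zero_of_gt hφ hR.le hRR' hY, mul_zero, zero_smul]
      simp [hv, h1, h2]
    · replace hY := not_lt.1 hY
      set Y' : EuclideanSpace ℝ (Fin 3) := Y + (-(Y 2)) • eZ with hY'
      have hvY : v Y = v Y' := (hvcol Y (-(Y 2))).symm
      have hY'mem : Y' ∈ closedBall (0 : EuclideanSpace ℝ (Fin 3)) R' := by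
        rw [mem_closedBall, dist_zero_right]
        have hsq : ‖Y'‖ ^ 2 = Y 0 ^ 2 + Y 1 ^ 2 := by
          rw [EuclideanSpace.real_norm_sq_eq, Fin.sum_univ_three]
          simp [hY', eZ]
        have hR'0 : 0 ≤ R' := by linarith
        exact (pow_le_pow_iff_left₀ (norm_nonneg _) hR'0 two_ne_zero).1 (by rw [hsq]; exact hY)
      rw [hvY]
      exact (hM Y' hY'mem).trans (le_max_left _ _)

end Cutoff

end ColumnarComparisonDatum

end Summit.NavierStokesRegularity.NavierStokesRegularity.Theorems

end
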